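import Summits.BirchSwinnertonDyer.BirchSwinnertonDyer.Theorems.KolyvaginDepthDoorDepthTableSteinWuthrichRankThree22481a1RankZeroField
import Summits.BirchSwinnertonDyer.BirchSwinnertonDyer.Theorems.KolyvaginDepthDoorDepthTableSteinWuthrichEvenRankBSDQuotient
import Summits.BirchSwinnertonDyer.BirchSwinnertonDyer.Theorems.Rank1ResidualIntModelSurjectivity
import Summits.BirchSwinnertonDyer.Rank1Residual.Additive.PointCountEulerNat
import Literature.NumberTheory.EllipticCurves.GlobalMinimalModelNumberFieldBaseChangeProofs
import Literature.NumberTheory.EllipticCurves.LocalReductionKrausMinimality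
import Literature.NumberTheory.EllipticCurves.SelmerTorsionTwistRestriction
import Literature.NumberTheory.EllipticCurves.ComplexMultiplicationNotSemistable
import HarnessLib

/-!
# Route `KolyvaginDepthDoor`, crux `KolyvaginDepthSupplyKN` (stmt-BirchSwinnertonDyer-22820) —
# DEPTH TABLE v14b COMPLETED: the RANK-ZERO DATUM of the odd-rank row `22481a1` at `d_K = −8` READ AS ONE `L`-VALUE VALUATION
# (Kraus's test at `2` certifies the minimal twist model; Skinner 2016 Thm. C and Gross–Zagier–Kolyvagin BY NAME)

Helper file of the lead prover of line `levelone` (kdd-p1 g19; `--supports stmt-BirchSwinnertonDyer-22820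
--as helper`); it closes nothing and BSD is NOT proved by it.

g18's `CLOSING-DATA-v14.md` (v14b) left the two `d_K = −8` rows of the odd-rank table (`21443a1`, `22481a1`) in Selmer-bound
currency only: «no certified minimal model: `v₂(Δ) = 18` for the `b`-model, Kraus needed». The tree HAS Kraus's test as a kernel
criterion (`Literature/…/LocalReductionKrausMinimality.lean`, `isGloballyMinimal_of_int_kraus`): for `T = 22481a1^{(−8)}` the model
`T₀ = [0, 0, 0, 404, -1968]` (`Δ(T₀) = −2^18 · 22481`, `c₄ = -19392` with `2⁸ ∤ c₄`) passes it, so it IS globally minimal, and g18's `L`-value reading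
(`natCard_selmerGroup_eq_one_of_rankZero_LValue`: Skinner 2016 Thm. C + GZK) applies verbatim: `L(T,1) ≠ 0` (numerically, g18:
`L ≈ 5.98`) and `ord_5(L(T,1)/Ω_T) ≤ 0` ⟹ `#Sel_5(T) = 1` ⟹ (`C22481a1.cruxBody_of_twistSelmer_neg8`) the crux's clause at `22481a1`.

Kernel certificates (all `decide`): `minTwist8_isElliptic`, `minTwist8_isGloballyMinimal` (Kraus at `2`, Silverman at odd primes),
`minTwist8_intModel`, `minTwist8_smul_eq` (`(1, 2, 0, 0) • T₀ = E.quadraticTwist (−8)`), `minTwist8_card_5` (good ORDINARY),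
`minTwist8_hasSurjectiveModNGaloisRep_5` (Serre Prop. 19 witnesses; `T` is additive at `2`), `minTwist8_not_hasCM`,
`minTwist8_hasMultiplicativeReductionAtPrime_22481` (`v_22481(Δ_T) = 1`: Skinner's ramified prime), `minTwist8_kodairaNeron_5`.

* `minTwist8_natCard_selmerGroup_eq_one_of_LValue`, `natCard_selmerGroup_quadraticTwist_neg8_eq_one_of_LValue`,
  `cruxBody_of_twistLValue` — as in the seven `d_K = −7` files of g18 (`…RankThree<label>TwistLValue`, `…TwistLValueCompositions`).

Per curve; nothing class-wide (the open stub (S♭) is untouched); BSD is NOT proved by any of this.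

References: [Kraus1989] Prop. 2; [CremonaAlgorithms1997] §3.2; [Skinner2016PacificMC] Thm. C (p. 173); [Darmon2004] Thm. 3.22;
[Serre1972] §2.8 Prop. 19; [SilvermanAEC2009] VII.1 Rem. 1.1, VIII.8, X.4.2, X.5 Cor. 5.4.
-/


set_option linter.dupNamespace false

noncomputable section

open scoped Classical NumberField

namespace Summit.BirchSwinnertonDyer.BirchSwinnertonDyer.Theorems.KolyvaginDepthDoor

open Literature.NumberTheory.EllipticCurves Literature.NumberTheory.EllipticCurves.ModularForms
  WeierstrassCurve NumberField IsDedekindDomain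
open Summit.BirchSwinnertonDyer.BirchSwinnertonDyer.Theorems
open Summit.BirchSwinnertonDyer.BirchSwinnertonDyer.Rank2Observatory
open Summit.BirchSwinnertonDyer.BirchSwinnertonDyer.Rank1Residual
open Summit.BirchSwinnertonDyer.Rank1Residual.Additive

namespace C22481a1

/-! ## The minimal model `T₀ = [0, 0, 0, 404, -1968]` of the twist `22481a1^{(-8)}` -/

/-- `T₀ = [0, 0, 0, 404, -1968]` is an elliptic curve over `ℚ` (`Δ = -5893259264 ≠ 0`, kernel-checked). [folklore] -/
theorem minTwist8_isElliptic : ((⟨0, 0, 0, 404, -1968⟩ : WeierstrassCurve ℤ).map (Int.castRingHom ℚ)).IsElliptic := by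
  rw [WeierstrassCurve.isElliptic_iff, WeierstrassCurve.map_Δ, isUnit_iff_ne_zero, eq_intCast, Int.cast_ne_zero]
  decide +kernel

/-- **`T₀ = [0, 0, 0, 404, -1968]` is a GLOBAL MINIMAL model** (unconditional): `Δ(T₀) = −2^18 · 22481`. At `2` Silverman's
criterion fails (`2¹² ∣ Δ`, `2⁴ ∣ c₄ = -19392`) and KRAUS'S TEST decides: `2²⁴ ∤ Δ`, not (`2⁸ ∣ c₄` and `c₆ ≡ 0, 2⁹ (mod 2¹¹)`),
`2⁸ ∤ c₆ + 2⁶` (`c₆ = 1700352`) — no integral model with `Δ/2¹²` exists, so `T₀` is minimal at `2` (tree theorem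
`isGloballyMinimal_of_int_kraus`, Kraus 1989 Prop. 2 / Cremona §3.2); at the odd primes `q¹² ∤ Δ` (`q < 7` by table, `q ≥ 7` by
`|Δ| < 7¹²`). [cite: Kraus1989, Prop. 2] [cite: CremonaAlgorithms1997, §3.2 (PDF p. 51)] [cite: SilvermanAEC2009, VII.1 Remark 1.1 and VIII.8] -/
theorem minTwist8_isGloballyMinimal : ((⟨0, 0, 0, 404, -1968⟩ : WeierstrassCurve ℤ).map (Int.castRingHom ℚ)).IsGloballyMinimal := by
  have h : ((⟨0, 0, 0, 404, -1968⟩ : WeierstrassCurve ℤ).map (Int.castRingHom ℚ)) = (⟨(0 : ℤ), (0 : ℤ), (0 : ℤ), (404 : ℤ), (-1968 : ℤ)⟩ : WeierstrassCurve ℚ) := by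
    ext <;> simp [WeierstrassCurve.map]
  rw [h]
  refine isGloballyMinimal_of_int_kraus 0 0 0 404 (-1968) fun q hq => ?_
  rcases lt_or_ge q 7 with hlt | hge
  · interval_cases q <;>
      first
        | exact absurd hq (by decide)
        | exact Or.inl (by decide +kernel)
        | exact Or.inr (Or.inl ⟨rfl, by decide +kernel, by decide +kernel, by decide +kernel⟩)
  · exact Or.inl (not_pow_twelve_dvd_and_of_natAbs_lt (by decide +kernel) (M := 7) (by decide +kernel) hge)

/-- The integral model `[0, 0, 0, 404, -1968]` is its own `integralModelInt` (globally minimal). [folklore] -/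
theorem minTwist8_intModel :
    haveI := minTwist8_isGloballyMinimal;
    integralModelInt ((⟨0, 0, 0, 404, -1968⟩ : WeierstrassCurve ℤ).map (Int.castRingHom ℚ)) = ⟨0, 0, 0, 404, -1968⟩ := by
  haveI := minTwist8_isGloballyMinimal
  exact IntModel.integralModelInt_eq_of_map_eq _ rfl

/-- **`T₀` is `ℚ`-isomorphic to the tree's twist `E.quadraticTwist (-8)` of `E = 22481a1`** by the change of variables
`(u, r, s, t) = (1, 2, 0, 0)`: `(u,r,s,t) • T₀ = ⟨0, d·b₂/4, 0, d²·b₄/2, d³·b₆/4⟩` with `(b₂, b₄, b₆)(E) = (-3, 13, 9)`,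
`d = -8`. [cite: SilvermanAEC2009, X.5 Cor. 5.4] -/
theorem minTwist8_smul_eq :
    (⟨1, (2 : ℚ), (0 : ℚ), (0 : ℚ)⟩ : WeierstrassCurve.VariableChange ℚ) •
        ((⟨0, 0, 0, 404, -1968⟩ : WeierstrassCurve ℤ).map (Int.castRingHom ℚ)) =
      (c22481a1.e.baseChange ℚ).quadraticTwist ((-8) : ℚ) := by
  haveI := isElliptic_of_mem_atlasR3A00 mem_atlas
  haveI := isGloballyMinimal_of_mem_atlasR3A00 mem_atlas
  have hE : (c22481a1.e.baseChange ℚ) = (⟨1, -1, 1, 6, 2⟩ : WeierstrassCurve ℤ).baseChange ℚ := eq_baseChange_of_intModel intModel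
  rw [hE]
  ext <;> simp only [WeierstrassCurve.map_a₁, WeierstrassCurve.map_a₂, WeierstrassCurve.map_a₃,
      WeierstrassCurve.map_a₄, WeierstrassCurve.map_a₆, WeierstrassCurve.variableChange_a₁,
      WeierstrassCurve.variableChange_a₂, WeierstrassCurve.variableChange_a₃,
      WeierstrassCurve.variableChange_a₄, WeierstrassCurve.variableChange_a₆, WeierstrassCurve.quadraticTwist,
      WeierstrassCurve.b₂, WeierstrassCurve.b₄, WeierstrassCurve.b₆, WeierstrassCurve.baseChange, Units.val_one, inv_one,
      eq_intCast] <;> norm_num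

/-- `#T̃₀(𝔽_5) = 3`, i.e. `a_5(T) = 3` (kernel-decided, `ℕ`-arithmetic Euler count). [cite: SilvermanAEC2009, V.2] -/
theorem minTwist8_card_5 :
    Nat.card (((⟨0, 0, 0, 404, -1968⟩ : WeierstrassCurve ℤ).map (Int.castRingHom (ZMod 5))).toAffine.Point) = 3 := by
  rw [PointCountNat.natCard_point_map_eq (hℓ := ⟨by norm_num⟩) (by norm_num) 0 0 0 404 (-1968)
    (by decide +kernel)]
  decide +kernel

/-- `#T̃₀(𝔽_7) = 4`, i.e. `a_7(T) = 4` (kernel-decided, `ℕ`-arithmetic Euler count). [cite: SilvermanAEC2009, V.2] -/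
theorem minTwist8_card_7 :
    Nat.card (((⟨0, 0, 0, 404, -1968⟩ : WeierstrassCurve ℤ).map (Int.castRingHom (ZMod 7))).toAffine.Point) = 4 := by
  rw [PointCountNat.natCard_point_map_eq (hℓ := ⟨by norm_num⟩) (by norm_num) 0 0 0 404 (-1968)
    (by decide +kernel)]
  decide +kernel

/-- `#T̃₀(𝔽_43) = 50`, i.e. `a_43(T) = -6` (kernel-decided, `ℕ`-arithmetic Euler count). [cite: SilvermanAEC2009, V.2] -/
theorem minTwist8_card_43 :
    Nat.card (((⟨0, 0, 0, 404, -1968⟩ : WeierstrassCurve ℤ).map (Int.castRingHom (ZMod 43))).toAffine.Point) = 50 := by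
  rw [PointCountNat.natCard_point_map_eq (hℓ := ⟨by norm_num⟩) (by norm_num) 0 0 0 404 (-1968)
    (by decide +kernel)]
  decide +kernel

/-- **`5` is a prime of good ORDINARY reduction for `T`** (`5 ∤ Δ_T`, `a_5(T) = 3 ≢ 0`). [cite: SilvermanAEC2009, VII.5 Prop. 5.1 (a)] -/
theorem minTwist8_goodOrdinary_5 :
    haveI := minTwist8_isGloballyMinimal;
    haveI := Fact.mk (by norm_num : Nat.Prime 5);
    ((⟨0, 0, 0, 404, -1968⟩ : WeierstrassCurve ℤ).map (Int.castRingHom ℚ)).HasGoodReductionAtPrime 5 ∧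
      ¬ ((5 : ℕ) : ℤ) ∣ ((⟨0, 0, 0, 404, -1968⟩ : WeierstrassCurve ℤ).map (Int.castRingHom ℚ)).frobeniusTrace 5 := by
  haveI := minTwist8_isGloballyMinimal
  haveI := Fact.mk (by norm_num : Nat.Prime 5)
  exact goodOrdinary_of_intModel_certificate minTwist8_intModel 5 (by decide +kernel) (n := 3) minTwist8_card_5
    (by decide +kernel)

/-- **`ρ̄_{T,5}` is surjective** (unconditional; `T` is ADDITIVE at the primes of `d_K`, so Serre's Prop. 21 for semistable
curves is unavailable — Serre's Prop. 19 instead, tree theorem `IntModel.hasSurjectiveModNGaloisRep_of_intModel_of_serreWitnesses`):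
Frobenius witnesses i) `q = 43`, `a = -6`: `a² − 4q` a non-zero square mod `5`, `a ≢ 0`; ii) `q = 7`, `a = 4`: `a² − 4q` a
non-square, `a ≢ 0`; iii) `q = 7`, `a = 4`: `u = a²/q ≡ 3`, `u ∉ {0,1,2,4}`, `u² − 3u + 1 ≢ 0` — all kernel-decided
(`a_q(T) = ±a_q(E)`: the Serre conditions are twist-invariant). [cite: Serre1972, §2.8 Prop. 19 and §5.2 (iii)] -/
theorem minTwist8_hasSurjectiveModNGaloisRep_5 :
    haveI := minTwist8_isGloballyMinimal;
    ((⟨0, 0, 0, 404, -1968⟩ : WeierstrassCurve ℤ).map (Int.castRingHom ℚ)).HasSurjectiveModNGaloisRep (5 : ℕ) := by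
  have hi : IsSquare (((((43 : ℕ) : ℤ) + 1 - (50 : ℕ) : ℤ) : ZMod 5) ^ 2 - 4 * ((43 : ℕ) : ZMod 5)) ∧
      ((((43 : ℕ) : ℤ) + 1 - (50 : ℕ) : ℤ) : ZMod 5) ^ 2 - 4 * ((43 : ℕ) : ZMod 5) ≠ 0 ∧
        ((((43 : ℕ) : ℤ) + 1 - (50 : ℕ) : ℤ) : ZMod 5) ≠ 0 := by
    decide +kernel
  have hii : ¬ IsSquare (((((7 : ℕ) : ℤ) + 1 - (4 : ℕ) : ℤ) : ZMod 5) ^ 2 - 4 * ((7 : ℕ) : ZMod 5)) ∧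
      ((((7 : ℕ) : ℤ) + 1 - (4 : ℕ) : ℤ) : ZMod 5) ≠ 0 := by
    decide +kernel
  have hiii : ∃ u : ZMod 5, ((((7 : ℕ) : ℤ) + 1 - (4 : ℕ) : ℤ) : ZMod 5) ^ 2 = u * ((7 : ℕ) : ZMod 5) ∧
      u ≠ 0 ∧ u ≠ 1 ∧ u ≠ 2 ∧ u ≠ 4 ∧ u ^ 2 - 3 * u + 1 ≠ 0 := ⟨3, by decide +kernel⟩
  haveI := Fact.mk (by norm_num : Nat.Prime 5)
  haveI := Fact.mk (by norm_num : Nat.Prime 7)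
  haveI := Fact.mk (by norm_num : Nat.Prime 43)
  haveI := minTwist8_isElliptic
  haveI := minTwist8_isGloballyMinimal
  exact IntModel.hasSurjectiveModNGaloisRep_of_intModel_of_serreWitnesses minTwist8_intModel 5 (by norm_num) 43 7 7
    (by norm_num) (by norm_num) (by norm_num) (by decide +kernel) (by decide +kernel) (by decide +kernel)
    (n₁ := 50) (n₂ := 4) (n₃ := 4) minTwist8_card_43 minTwist8_card_7 minTwist8_card_7 hi hii hiii

/-- **`T` is not CM** (multiplicative reduction at `22481`: `22481 ∣ Δ_T`, `22481 ∤ c₄(T) = -19392`; a CM curve has integral `j`).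
[cite: SilvermanATAEC1994, Thm. II.6.4 (PDF p. 148)] -/
theorem minTwist8_not_hasCM :
    haveI := minTwist8_isElliptic;
    ¬ ((⟨0, 0, 0, 404, -1968⟩ : WeierstrassCurve ℤ).map (Int.castRingHom ℚ)).HasCM := by
  haveI := minTwist8_isElliptic
  haveI := minTwist8_isGloballyMinimal
  haveI := Fact.mk (by norm_num : Nat.Prime 22481)
  intro hCM
  exact not_hasMultiplicativeReductionAtPrime_of_hasCM _ hCM 22481
    (IntModel.hasMultiplicativeReductionAtPrime_of_intModel minTwist8_intModel 22481 (by decide +kernel)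
      (by decide +kernel))

/-- **`T` has multiplicative reduction at `22481` with `v_22481(Δ_T) = 1`** (`22481 ∣ Δ_T`, `22481 ∤ c₄(T) = -19392`): Skinner's ramified
auxiliary prime (`5 ∤ 1`). [cite: SilvermanAEC2009, VII.5 Prop. 5.1 (b)] -/
theorem minTwist8_hasMultiplicativeReductionAtPrime_22481 :
    haveI := minTwist8_isElliptic; haveI := minTwist8_isGloballyMinimal;
    haveI := Fact.mk (by norm_num : Nat.Prime 22481);
    ((⟨0, 0, 0, 404, -1968⟩ : WeierstrassCurve ℤ).map (Int.castRingHom ℚ)).HasMultiplicativeReductionAtPrime 22481 ∧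
      padicValInt 22481 ((⟨0, 0, 0, 404, -1968⟩ : WeierstrassCurve ℤ).map (Int.castRingHom ℚ)).minimalDiscriminantInt = 1 := by
  haveI := minTwist8_isElliptic
  haveI := minTwist8_isGloballyMinimal
  haveI := Fact.mk (by norm_num : Nat.Prime 22481)
  refine ⟨IntModel.hasMultiplicativeReductionAtPrime_of_intModel minTwist8_intModel 22481 (by decide +kernel)
      (by decide +kernel), ?_⟩
  rw [IntModel.minimalDiscriminantInt_eq minTwist8_intModel]
  exact IntModel.padicValInt_eq_of_dvd_of_not_dvd 22481 (e := 1) (by decide +kernel) (by decide +kernel)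

/-- **Kodaira–Néron for `T` at `5`**: `5 ∤ ord_v(Δ_T)` at every multiplicative place (`|Δ_T| < 90^5`; prime-power
factorisation `2^18`, `22481^1`, read by the table `not_dvd_ordMinimalDiscriminant_of_intModel_table` with the
exponents supplied by hand from the factorisation). Hence `5 ∤ Tam(T)` (`not_dvd_tamagawaProduct_of_kodairaNeron`: `c_v ≤ 4 < 5` at
additive `v`). [cite: SilvermanAEC2009, VII.5.1, VIII.8, C.15 Table 15.1] -/
theorem minTwist8_kodairaNeron_5 :
    haveI := minTwist8_isElliptic; haveI := minTwist8_isGloballyMinimal;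
    ∀ v : HeightOneSpectrum (𝓞 ℚ),
      ((⟨0, 0, 0, 404, -1968⟩ : WeierstrassCurve ℤ).map (Int.castRingHom ℚ)).HasMultiplicativeReductionAt v →
      ¬ 5 ∣ ((⟨0, 0, 0, 404, -1968⟩ : WeierstrassCurve ℤ).map (Int.castRingHom ℚ)).ordMinimalDiscriminant v := by
  haveI := minTwist8_isElliptic
  haveI := minTwist8_isGloballyMinimal
  exact not_dvd_ordMinimalDiscriminant_of_intModel_table minTwist8_intModel (p := 5) (Δ₀ := (-5893259264))
    (by decide +kernel) (B := 90) (by decide +kernel)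
    (by
      intro q hq hqP hqd
      have hn : ((-5893259264 : ℤ).natAbs) = 2 ^ 18 * (22481 ^ 1) := by norm_num
      rw [hn] at hqd ⊢
      rcases (Nat.Prime.dvd_mul hqP).mp hqd with h | h0
      · obtain rfl := (Nat.prime_dvd_prime_iff_eq hqP (by norm_num)).mp (hqP.dvd_of_dvd_pow h)
        exact ⟨18, by simp, by decide +kernel, by decide +kernel, by norm_num⟩
      · obtain rfl := (Nat.prime_dvd_prime_iff_eq hqP (by norm_num)).mp (hqP.dvd_of_dvd_pow h0)
        exact absurd (Finset.mem_range.mp hq) (by norm_num)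
      )

/-! ## The rank-zero datum as an `L`-value valuation (Skinner 2016 Thm. C, GZK, by name) -/

/-- **THE RANK-ZERO DATUM OF THE `22481a1` ROW AT `d_K = −8` AS ONE `L`-VALUE VALUATION (Skinner 2016 Thm. C + GZK by name).**
For the twist `T = 22481a1^{(−8)}` (minimal model `T₀ = [0, 0, 0, 404, -1968]`): IF `L(T, 1) ≠ 0` and the algebraic part `L(T,1)/Ω_T ∈ ℚ` has
`ord_5 ≤ 0`, THEN `#Sel_5(T/ℚ) = 1` (g18's generic `natCard_selmerGroup_eq_one_of_rankZero_LValue`: `r_an(T) = 0`, GZK rank `0` and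
`Ш(T)` finite, Skinner's `ord_5(L(T,1)/Ω_T) = ord_5 #Ш(T) + ord_5 Tam(T)` at good ordinary `5`, `T[5]` irreducible (from `ρ̄_{T,5}` onto),
the ramified multiplicative prime `22481`; Kodaira–Néron kills the Tamagawa term). CONDITIONAL on the two named facts; per curve; BSD is
not proved by it. [cite: Skinner2016PacificMC, Thm. C (p. 173)] [cite: Darmon2004, Thm. 3.22] [cite: SilvermanAEC2009, Thm. X.4.2] -/
theorem minTwist8_natCard_selmerGroup_eq_one_of_LValue
    (hSk : Skinner2016_padicValRat_bsd_rank_zero) (hGZK : rank_eq_analyticRank_of_analyticRank_le_one)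
    (hL : haveI := minTwist8_isElliptic;
      ((⟨0, 0, 0, 404, -1968⟩ : WeierstrassCurve ℤ).map (Int.castRingHom ℚ)).entireLFunction 1 ≠ 0)
    (hval : haveI := minTwist8_isElliptic; haveI := minTwist8_isGloballyMinimal;
      ∀ q : ℚ, ((⟨0, 0, 0, 404, -1968⟩ : WeierstrassCurve ℤ).map (Int.castRingHom ℚ)).entireLFunction 1 /
          ((((⟨0, 0, 0, 404, -1968⟩ : WeierstrassCurve ℤ).map (Int.castRingHom ℚ)).realPeriodRat : ℝ) : ℂ) = (q : ℂ) →
        padicValRat 5 q ≤ 0) :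
    haveI := minTwist8_isElliptic;
    Nat.card (((⟨0, 0, 0, 404, -1968⟩ : WeierstrassCurve ℤ).map (Int.castRingHom ℚ)).selmerGroup (5 : ℕ)) = 1 := by
  haveI := minTwist8_isElliptic
  haveI := minTwist8_isGloballyMinimal
  haveI i5 := Fact.mk (by norm_num : Nat.Prime 5)
  haveI := Fact.mk (by norm_num : Nat.Prime 22481)
  have hirr : ((⟨0, 0, 0, 404, -1968⟩ : WeierstrassCurve ℤ).map (Int.castRingHom ℚ)).HasIrreducibleModPGaloisRep 5 :=
    hasIrreducibleModPGaloisRep_of_hasSurjectiveModNGaloisRep _ 5 minTwist8_hasSurjectiveModNGaloisRep_5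
  exact natCard_selmerGroup_eq_one_of_rankZero_LValue hSk hGZK _ 5 (by norm_num) (Or.inl minTwist8_goodOrdinary_5) hirr
    ⟨22481, inferInstance, by norm_num, minTwist8_hasMultiplicativeReductionAtPrime_22481.1,
      by rw [minTwist8_hasMultiplicativeReductionAtPrime_22481.2]; norm_num⟩
    minTwist8_kodairaNeron_5 hL hval

/-- **The same datum on the tree's twist `E.quadraticTwist (−8)`** (`E = 22481a1`): under the two `L`-value hypotheses,
`#Sel_5(E^{(−8)}/ℚ) = 1` — transported along `minTwist8_smul_eq` (`natCard_selmerGroup_eq_of_variableChange`): (more than) the hypothesis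
`hT : #Sel_5(E^{(d_K)}) ≤ 5³` of `C22481a1.cruxBody_of_twistSelmer_neg8` for every `K` with `d_K = −8`. CONDITIONAL on Skinner 2016 Thm. C and GZK by
name; per curve; BSD is not proved by it. [cite: Skinner2016PacificMC, Thm. C (p. 173)] [cite: Darmon2004, Thm. 3.22] [cite: SilvermanAEC2009, X.§4] -/
theorem natCard_selmerGroup_quadraticTwist_neg8_eq_one_of_LValue
    (hSk : Skinner2016_padicValRat_bsd_rank_zero) (hGZK : rank_eq_analyticRank_of_analyticRank_le_one)
    (hL : haveI := minTwist8_isElliptic;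
      ((⟨0, 0, 0, 404, -1968⟩ : WeierstrassCurve ℤ).map (Int.castRingHom ℚ)).entireLFunction 1 ≠ 0)
    (hval : haveI := minTwist8_isElliptic; haveI := minTwist8_isGloballyMinimal;
      ∀ q : ℚ, ((⟨0, 0, 0, 404, -1968⟩ : WeierstrassCurve ℤ).map (Int.castRingHom ℚ)).entireLFunction 1 /
          ((((⟨0, 0, 0, 404, -1968⟩ : WeierstrassCurve ℤ).map (Int.castRingHom ℚ)).realPeriodRat : ℝ) : ℂ) = (q : ℂ) →
        padicValRat 5 q ≤ 0) :
    haveI := isElliptic_of_mem_atlasR3A00 mem_atlas;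
    haveI := isGloballyMinimal_of_mem_atlasR3A00 mem_atlas;
    Nat.card (((c22481a1.e.baseChange ℚ).quadraticTwist ((-8) : ℚ)).selmerGroup (5 : ℕ)) = 1 := by
  haveI := isElliptic_of_mem_atlasR3A00 mem_atlas
  haveI := isGloballyMinimal_of_mem_atlasR3A00 mem_atlas
  rw [← natCard_selmerGroup_eq_of_variableChange ((5 : ℕ) : ℤ) minTwist8_smul_eq]
  exact minTwist8_natCard_selmerGroup_eq_one_of_LValue hSk hGZK hL hval

/-- **THE CRUX `KolyvaginDepthSupplyKN` AT `22481a1`, MODULO PRINT AND ONE `L`-VALUE VALUATION** — the `d_K = −8` row of g18's v14b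
table, now in `L`-value currency: granted Stein–Wuthrich 2013 Thm. 1.1, W. Zhang 2014 L8.4 (1) / Thm. 9.1, Skinner 2016 Thm. C and
GZK by name, and for ONE imaginary quadratic `K` with `d_K = −8` the two hypotheses `L(T,1) ≠ 0`, `ord_5(L(T,1)/Ω_T) ≤ 0` on the
rank-zero twist `T = E^{(−8)}`, the CLAUSE of the crux holds at `W = 22481a1` VERBATIM (`C22481a1.cruxBody_of_twistSelmer_neg8` fed with
`natCard_selmerGroup_quadraticTwist_neg8_eq_one_of_LValue`, `1 ≤ 5³`). CONDITIONAL on the named facts and the two hypotheses; per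
curve (the open stub (S♭) is untouched); BSD is not proved by it. [cite: SteinWuthrich2013, Thm. 1.1 (p. 1758)]
[cite: WZhang2014, Lemma 8.4 (1) (p. 236), Thm. 9.1 (p. 240)] [cite: Skinner2016PacificMC, Thm. C (p. 173)] [cite: Darmon2004, Thm. 3.22] -/
theorem cruxBody_of_twistLValue
    (hSW : SteinWuthrich2013_sha_inf_torsionBy_eq_bot_of_two_le_rank)
    (h84 : Literature.NumberTheory.EllipticCurves.WZhang2014_lemma84_exists_minimal_kolyvaginClass_one_selmerCard)
    (hSk : Skinner2016_padicValRat_bsd_rank_zero) (hGZK : rank_eq_analyticRank_of_analyticRank_le_one)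
    (K : Type) [Field K] [NumberField K] (hK : IsImaginaryQuadratic K) (hD : NumberField.discr K = -8)
    (hL : haveI := minTwist8_isElliptic;
      ((⟨0, 0, 0, 404, -1968⟩ : WeierstrassCurve ℤ).map (Int.castRingHom ℚ)).entireLFunction 1 ≠ 0)
    (hval : haveI := minTwist8_isElliptic; haveI := minTwist8_isGloballyMinimal;
      ∀ q : ℚ, ((⟨0, 0, 0, 404, -1968⟩ : WeierstrassCurve ℤ).map (Int.castRingHom ℚ)).entireLFunction 1 /
          ((((⟨0, 0, 0, 404, -1968⟩ : WeierstrassCurve ℤ).map (Int.castRingHom ℚ)).realPeriodRat : ℝ) : ℂ) = (q : ℂ) →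
        padicValRat 5 q ≤ 0) :
    haveI := isElliptic_of_mem_atlasR3A00 mem_atlas;
    haveI := isGloballyMinimal_of_mem_atlasR3A00 mem_atlas;
    ∃ (p : ℕ) (hp : Fact p.Prime), 5 ≤ p ∧ (c22481a1.e.baseChange ℚ).HasGoodReductionAtPrime p ∧
      ¬ (p : ℤ) ∣ (c22481a1.e.baseChange ℚ).frobeniusTrace p ∧ (∀ n : ℕ, (c22481a1.e.baseChange ℚ).HasSurjectiveModNGaloisRep (p ^ n : ℕ)) ∧
      (∀ v : HeightOneSpectrum (𝓞 ℚ), (c22481a1.e.baseChange ℚ).HasMultiplicativeReductionAt v →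
        ¬ p ∣ (c22481a1.e.baseChange ℚ).ordMinimalDiscriminant v) ∧
      ∃ (K : Type) (_ : Field K) (_ : NumberField K), IsImaginaryQuadratic K ∧
        NumberField.discr K ≠ -3 ∧ NumberField.discr K ≠ -4 ∧
        ∃ (_ : NeZero ((c22481a1.e.baseChange ℚ).conductorNorm ℤ)), SatisfiesHeegnerHypothesis ((c22481a1.e.baseChange ℚ).conductorNorm ℤ) K ∧
        ∃ (Dt : ModularParametrizationData (c22481a1.e.baseChange ℚ) ((c22481a1.e.baseChange ℚ).conductorNorm ℤ)) (β : ℤ) (ι : K →+* ℂ) (n₁ : ℕ)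
          (d : KolyvaginHeegnerData Dt β ι n₁), Squarefree n₁ ∧
          (∀ q ∈ n₁.primeFactors, Zhang2014.IsKolyvaginPrime ((c22481a1.e.baseChange ℚ).conductorNorm ℤ) (c22481a1.e.baseChange ℚ) K p q) ∧
          d.kolyvaginClass hp.out 1 ≠ 0 ∧
          (n₁.primeFactors.card + 1 ≤ (c22481a1.e.baseChange ℚ).mordellWeilRank ∨
            (n₁.primeFactors.card ≤ (c22481a1.e.baseChange ℚ).mordellWeilRank ∧
              n₁.primeFactors.card + 1 ≤ ((c22481a1.e.baseChange ℚ).quadraticTwist (NumberField.discr K : ℚ)).mordellWeilRank)) := by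
  haveI := isElliptic_of_mem_atlasR3A00 mem_atlas
  haveI := isGloballyMinimal_of_mem_atlasR3A00 mem_atlas
  have h1 := natCard_selmerGroup_quadraticTwist_neg8_eq_one_of_LValue hSk hGZK hL hval
  refine cruxBody_of_twistSelmer_neg8 hSW h84 K hK hD ?_
  have hcast : (NumberField.discr K : ℚ) = ((-8) : ℚ) := by rw [hD]; norm_num
  rw [hcast, h1]
  norm_num

end C22481a1

end Summit.BirchSwinnertonDyer.BirchSwinnertonDyer.Theorems.KolyvaginDepthDoor

end
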